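import Literature.AlgebraicGeometry.Resolution.PrimeDivisorIdeals
import Literature.AlgebraicGeometry.Resolution.StalkSpecializesLocalization
import Literature.AlgebraicGeometry.Resolution.MarkedIdeals
import Mathlib.RingTheory.Localization.Ideal
import HarnessLib

/-!
# Crux `PatchingRelPerfect` (stmt-ResolutionOfSingularities-16161), chain W5.2 — F7(β) (β-AX) X3 C-I (M2b-T), (T-h-contract): CONTRACTION
# ALONG A SPECIALISATION — a germ lying in a PRIME stalk ideal at a generization lies in it at the special point
# (`…DepthPhaseCContactContraction`)

[OURS · L1 W5.2 · F7(β) (β-AX) X3 C-I (M2b-T) · `D/res-D-repro-1/M2bT-ASSEMBLY-PLAN.md` (T-h); res-L1-w52-tri-2 21:17:30Z «the step η ↦ x uses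
𝔭R_𝔭 ∩ R = 𝔭»; hand res-D-repro-1 AS res-L1-repro-3] The second local brick of the 𝒳-package΄s `hcomp`: along a specialisation `η ⤳ x`, the stalk
`𝒪_{X,η}` is the localisation of `𝒪_{X,x}` at `𝔭_η` (tree `isLocalizationAtPrime_stalkSpecializes`) and `D_η = D_x·𝒪_{X,η}` (tree
`stalkIdeal_map_stalkSpecializes`); hence for an ideal sheaf `D` whose stalk `D_x` is PRIME and which vanishes at `η` (`D_x ≤ 𝔭_η`), a section
whose germ at `η` lies in `D_η` has its germ at `x` in `D_x` (`𝔭R_𝔭 ∩ R = 𝔭`, Mathlib `IsLocalization.under_map_of_isPrime_disjoint`) —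
**`germ_mem_stalkIdeal_of_specializes`**.  With the Krull brick (`…ContactKrull`: `f ∈ (d)` at the generic point of a component inside the trace
`V(d)`) and the stalk NF (`…ContactNF`), this contracts «a component of the contact surface lies in a member trace» to a contradiction at `x`.
Def-free, fact-free; NOT a statement of the manuscript under review; AI-written, weaker than expert review.

## References
* The Stacks Project, Tag 01J7 (stalks at generizations are localisations). [StacksProject]
* H. Matsumura, *Commutative Ring Theory* (1987), Thm. 4.1 / §4 (extension and contraction of primes under localisation). [Matsumura1987]
-/

-- `Summit.<Summit>.<Sub>.Theorems` with `Sub = Summit` (single-conjunct summit, D-0017)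
set_option linter.dupNamespace false

noncomputable section

open CategoryTheory AlgebraicGeometry TopologicalSpace IsLocalRing
open Literature.AlgebraicGeometry.Resolution
open Scheme.IdealSheafData

namespace Summit.ResolutionOfSingularities.ResolutionOfSingularities.Theorems

namespace ContactContraction

universe u

variable {X : Scheme.{u}}

/-- [OURS · L1 W5.2 · (M2b-T) (T-h-contract)] `D` vanishes at the generization `η` iff its stalk at `x` lies in the prime `𝔭_η` of `η`.
[cite: StacksProject, Tag 01J7] -/
theorem stalkIdeal_le_primeOfSpecializes_iff {η x : X} (h : η ⤳ x) (D : X.IdealSheafData) :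
    stalkIdeal D x ≤ primeOfSpecializes h ↔ η ∈ D.support := by
  rw [mem_support_iff_stalkIdeal_le, ← stalkIdeal_map_stalkSpecializes D h, Ideal.map_le_iff_le_comap]

/-- [OURS · L1 W5.2 · (M2b-T) (T-h-contract)] **CONTRACTION `𝔭R_𝔭 ∩ R = 𝔭` ALONG A SPECIALISATION**: if the stalk `D_x` is prime and `D`
vanishes at the generization `η ⤳ x`, then an element of `𝒪_{X,x}` whose image in `𝒪_{X,η}` lies in `D_η` already lies in `D_x`.
[cite: StacksProject, Tag 01J7] [cite: Matsumura1987, Thm. 4.1] -/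
theorem mem_stalkIdeal_of_stalkSpecializes_mem {η x : X} (h : η ⤳ x) (D : X.IdealSheafData) (hprime : (stalkIdeal D x).IsPrime)
    (hη : η ∈ D.support) {a : X.presheaf.stalk x} (ha : (X.presheaf.stalkSpecializes h).hom a ∈ stalkIdeal D η) :
    a ∈ stalkIdeal D x := by
  letI := (X.presheaf.stalkSpecializes h).hom.toAlgebra
  haveI : IsLocalization.AtPrime (X.presheaf.stalk η) (primeOfSpecializes h) := isLocalizationAtPrime_stalkSpecializes h
  have hle : stalkIdeal D x ≤ primeOfSpecializes h := (stalkIdeal_le_primeOfSpecializes_iff h D).mpr hη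
  have hdisj : Disjoint ((primeOfSpecializes h).primeCompl : Set (X.presheaf.stalk x)) (stalkIdeal D x) :=
    Set.disjoint_left.mpr fun b hb hbD => hb (hle hbD)
  have hunder := IsLocalization.under_map_of_isPrime_disjoint (primeOfSpecializes h).primeCompl (X.presheaf.stalk η) hprime hdisj
  have hmap : (stalkIdeal D x).map (algebraMap (X.presheaf.stalk x) (X.presheaf.stalk η)) = stalkIdeal D η :=
    stalkIdeal_map_stalkSpecializes D h
  have ha' : a ∈ ((stalkIdeal D x).map (algebraMap (X.presheaf.stalk x) (X.presheaf.stalk η))).under (X.presheaf.stalk x) := by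
    rw [Ideal.under_def, Ideal.mem_comap, hmap]
    exact ha
  rwa [hunder] at ha'

/-- [OURS · L1 W5.2 · (M2b-T) (T-h-contract)] **The germ form**: a section whose germ at the generization `η` lies in `D_η` has its germ at
`x` in `D_x` (for `D_x` prime, `η ∈ V(D)`). [cite: StacksProject, Tag 01J7] -/
theorem germ_mem_stalkIdeal_of_specializes {η x : X} (h : η ⤳ x) (D : X.IdealSheafData) (hprime : (stalkIdeal D x).IsPrime)
    (hη : η ∈ D.support) {U : X.Opens} (hxU : x ∈ U) (f : Γ(X, U))
    (hf : X.presheaf.germ U η (h.mem_open U.isOpen hxU) f ∈ stalkIdeal D η) :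
    X.presheaf.germ U x hxU f ∈ stalkIdeal D x := by
  refine mem_stalkIdeal_of_stalkSpecializes_mem h D hprime hη ?_
  have hg := TopCat.Presheaf.germ_stalkSpecializes_apply X.presheaf hxU h f
  rw [hg]
  exact hf

end ContactContraction

end Summit.ResolutionOfSingularities.ResolutionOfSingularities.Theorems

end
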